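import Literature.AlgebraicGeometry.Resolution.Kuhlmann2019HenselianRationalitySteps
import Literature.AlgebraicGeometry.Resolution.ResidueTranscendentalExtensions
import HarnessLib

/-!
# Henselian rationality in finite rank: the ingredients of Kuhlmann 2019, Prop. 5.6

Topic: `Literature/AlgebraicGeometry/Resolution` (valued function fields). Second layer of the
decomposition of the named fact `Kuhlmann2019_Thm13_sepClosed`
(`Kuhlmann2019HenselianRationality.lean`) = F.-V. Kuhlmann, *Elimination of ramification II:
Henselian rationality*, Israel J. Math. 234 (2019) = arXiv:1701.05508, Thm. 1.3 for a separably
closed ground field: below `Kuhlmann2019HenselianRationalitySteps.lean` (the ingredients of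
Prop. 5.7, arbitrary rank) and `Kuhlmann2019HenselianRationalityProofs.lean` (Thm. 1.3 from
them), this file vendors the two printed ingredients of the proof of **Prop. 5.6** (p. 13 of
the arXiv version) that are theories of their own —

> **Proposition 5.6.** Every immediate separable function field `(F|K,v)` of transcendence
> degree 1 over a separably tame field `(K,v)` of finite rank is henselian rational.
> *Proof.* Since `F` has finite rank and `F|K` is an immediate extension of transcendence
> degree 1, there exist places `P = P₁P₂P₃` where `P₁` and `P₃` may be trivial and `P₂` has
> rank 1 … By [17, Lemma 3.14] … Since `(F|K,P)` is immediate, it follows from Lemma 5.5 that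
> `v_{P₁}F = v_{P₁}K`, `v_{P₂}(FP₁) = v_{P₂}(KP₁)`, and that the algebraic extension
> `(FP₁P₂|KP₁P₂, P₃)` is immediate. Since the tame field `(KP₁P₂,P₃)` is defectless, the latter
> extension must be trivial. This yields that also `(FP₁|KP₁, P₂)` is immediate. By
> Proposition 5.3 … `(FP₁)^{h(P₂)} = KP₁(xP₁)^{h(P₂)}` for a suitable `x ∈ F` which is
> consequently transcendental over `K` with `xP₁` transcendental over `KP₁`. Applying Lemma 5.4
> with `Q = P₁` we see that `x` can be chosen to be a separating element for `F|K`, so that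
> `F|K(x)` is a finite separable extension. Our goal is to show that `F^{h(P)} = K(x)^{h(P)}`. …
> We have already noted that `(K,P₁)` is a separably tame and hence separably defectless
> field. Since `xP₁` is transcendental over `KP₁`, we can apply [16, Theorem 1] to find that
> `(K(x),P₁)` is a separably defectless field. By [4, Theorem (18.2)], also `(K(x)^{h(P₁)},P₁)`
> is a separably defectless field. … Since the extension `F|K(x)` is finite and separable,
> Lemma 2.1 shows that the same is true for the extension `(F^{h(P)}|K(x)^{h(P)},P₁)`. As this
> extension is also immediate and `(K(x)^{h(P)},P₁)` is a henselian separably defectless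
> field, it follows that the extension must be trivial, as desired.

namely, for the separably closed ground fields of the head fact (whose coarsenings `(K, P₁)`
are separably closed and whose proper residue fields `KP₁`, `KP₁P₂` are algebraically closed,
Knaf–Kuhlmann 2009, Lemma 2.1 = `KnafKuhlmann2009_Lemma21_holds`, so that the tameness
statements [17, Lemma 3.14] are not needed):

* **Prop. 5.2 / 5.3 in rank one** ("Every immediate separable function field `(F|K,v)` of
  transcendence degree 1 over a separable-algebraically closed field `(K,v)` of rank 1 is
  henselian rational", Prop. 5.2, p. 12; Prop. 5.3 is the same over separably tame fields of
  rank 1 and is, for a separable-algebraically closed `K`, literally Prop. 5.2): the named fact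
  `Kuhlmann2019_Prop52_sepClosed`. Its printed proof is §§3–4 of the paper (Lemma 5.1:
  Ostrowski and `p`-groups; the Artin–Schreier and Kummer normal forms, Props. 4.8, 4.9; and
  Kuhlmann–Vlahu, *The relative approximation degree in valued function fields*, Math. Z. 276
  (2014), Thm. 11.1) — the heart of the paper, the next layer of the decomposition.
* **[16, Theorem 1], the "separably defectless" clause, for `(K(x), P₁)` with `xP₁`
  transcendental over `KP₁`** (= Kuhlmann 2010, Thm. 1.1, quoted in the Steps file, for the
  valued rational function field `K(x)` with a RESIDUE-transcendental generator over a
  separably closed `K`; the Steps file vendors the value-transcendental twin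
  `Kuhlmann2010SeparablyDefectlessRational_sepClosed` used by Prop. 5.7): the named fact
  `Kuhlmann2010SeparablyDefectlessRationalRT_sepClosed`.

The remaining ingredients are in the tree: Lemma 5.4 (`Kuhlmann2019_Lemma54`, Steps file),
[4, Thm. (18.2)] (`Kuhlmann2010SeparablyDefectlessIffHenselization_holds`), Lemma 2.1
(`Kuhlmann2010HenselizationImmediate_holds`, `Kuhlmann2010HenselizationIsHenselian_holds`),
[19, Thm. 1.2] (`KuhlmannNovacoski2014_Thm12_holds`), Hensel's Lemma
(`Kuhlmann2010HenselsLemma_holds`). The assembly of `Kuhlmann2019_Prop56_sepClosed` from them —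
by induction on the rank of `(K, v)`, the coarsening `P₁` being taken one convex subgroup at a
time, with the passage `F^{h(P)} ⊆ K(x)^{h(P)}` obtained from the henselian element of
`FP₁ | KP₁(xP₁)` by Hensel's Lemma with respect to `P₁` (in `F.K(x)^{h(P₁)}`) and to `P` (in
`K(x)^{h(P)}`) instead of Lemma 5.5 (b), (c) and [17, Prop. 2.12] — is
`Kuhlmann2019HenselianRationalityFiniteRankProofs.lean` (in preparation, with its glue files
`HenselizationCoarsening.lean`, `HenselRootsAmbient.lean`, `CompositeResidueExtensions.lean`).

## Content

* NAMED FACTS `Kuhlmann2019_Prop52_sepClosed` (Prop. 5.2), `Kuhlmann2010SeparablyDefectlessRationalRT_sepClosed`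
  ([16, Thm. 1], separably defectless clause, residue-transcendental generator, separably
  closed ground field).
* PROVED API: `isValueCofinal_closure_of_isResidueTranscendental` (the cofinality hypothesis
  of [16, Thm. 1] is automatic for a residue-transcendental generator: `vK(x) = vK`,
  Kuhlmann 2010, Lemma 2.5), `Kuhlmann2010SeparablyDefectlessRationalRT_sepClosed.apply` (the
  fact with that hypothesis discharged), `Kuhlmann2019_Prop52_sepClosed.prop56_of_isRankOne`
  (the rank-one case of Prop. 5.6 is Prop. 5.2).

## Sources

* [K19] F.-V. Kuhlmann, *Elimination of ramification II: Henselian rationality*, Israel J.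
  Math. 234 (2019) 927–958 = arXiv:1701.05508: §5.1, Lemma 5.1, Prop. 5.2 (p. 12), Prop. 5.3,
  Lemma 5.4, Lemma 5.5, Prop. 5.6 (p. 13).
* [K10] = [16] F.-V. Kuhlmann, *Elimination of ramification I: The generalized stability
  theorem*, Trans. AMS 362 (2010) = arXiv:1003.5678: Thm. 1.1, §2.5 (residue-transcendental
  elements), Lemma 2.5.
* [KK09] H. Knaf, F.-V. Kuhlmann, Adv. Math. 221 (2009): Lemma 2.1.

## Rendering notes

* As in `Kuhlmann2019HenselianRationality.lean` / the Steps file: subfields `K ≤ F ≤ Ω` of ONE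
  valued field `(Ω, V)` (algebraically closed where henselizations occur),
  `K(x) = Subfield.closure (K ∪ {x})`, "valued function field of transcendence degree `1`" =
  `FGOver` + a transcendental `t ∈ F` with `F` algebraic over `K(t)`, "separable" =
  `SeparablyGeneratedOver`, "immediate" = `IsImmediateOver`.
* "`(K, v)` of rank 1" = `IsRankOne V K` (`HenselizedFunctionFields.lean`, Kuhlmann 2010 §2.1 in
  the overring form: `V ∩ K ≠ K` and its only overrings are `V ∩ K` and `K`).
* "`xP₁` transcendental over `KP₁`" = `IsResidueTranscendental V K x`
  (`GeneralizedStabilityRankOneHenselized.lean`: `x ∈ V` with residue transcendental over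
  `resField V K`).
-/

noncomputable section

namespace Literature.AlgebraicGeometry.Resolution

universe u

open IsLocalRing

/-! ### The named facts -/

/-- NAMED FACT — **Kuhlmann 2019, Prop. 5.2 (henselian rationality over separable-algebraically
closed base fields of rank one).** "Every immediate separable function field `(F|K, v)` of
transcendence degree 1 over a separable-algebraically closed field `(K, v)` of rank 1 is
henselian rational." — with (p. 1) "henselian rational if it admits a transcendence basis
`𝒯 ⊂ F` such that `F` lies in the henselization of the rational function field `K(𝒯)`".
Vendored exactly as the head fact `Kuhlmann2019_Thm13_sepClosed` (arbitrary rank) and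
`Kuhlmann2019_Prop56_sepClosed` (finite rank), with the extra hypothesis that `(K, V ∩ K)` has
rank one (`IsRankOne V K`: `V ∩ K ≠ K` and the only overrings of `V ∩ K` are `V ∩ K` and `K`,
Kuhlmann 2010 §2.1): for `(F|K, V)` immediate, `F|K` finitely generated, separably generated,
of transcendence degree `1`, there is `x ∈ F` transcendental over `K` with
`F ≤ K(x)^h = henselization V K(x)`. (Prop. 5.3, the same over separably tame fields of rank
one, reduces to it for separable-algebraically closed `K`: `K^{sep} = K`.) Its printed proof
(Lemma 5.1 — Ostrowski's lemma and `p`-groups: `F.K(x)^h | K(x)^h` is a tower of Galois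
extensions of degree `p` —, Props. 4.8 / 4.9 — the Artin–Schreier and Kummer steps of §4 built
on §3 —, and [23, Thm. 11.1] — Kuhlmann–Vlahu, the relative approximation degree: `y` can be
chosen in `F`) is the next layer of the decomposition. Users take
`(h : Kuhlmann2019_Prop52_sepClosed)`. [cite: Kuhlmann2019, Prop. 5.2] -/
def Kuhlmann2019_Prop52_sepClosed : Prop :=
  ∀ (Ω : Type u) [Field Ω] [IsAlgClosed Ω] (V : ValuationSubring Ω) (K F : Subfield Ω),
    IsSepClosed K → IsRankOne V K → K ≤ F → FGOver K F → SeparablyGeneratedOver K F →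
    (∃ x ∈ F, Transcendental K x ∧
      ∀ z ∈ F, IsAlgebraic (IntermediateField.adjoin K ({x} : Set Ω)) z) →
    IsImmediateOver V K F →
    ∃ x ∈ F, Transcendental K x ∧ F ≤ henselization V (Subfield.closure ((K : Set Ω) ∪ {x}))

/-- NAMED FACT — **Kuhlmann 2010, Thm. 1.1 (generalized stability theorem), the "separably
defectless" clause, for a rational function field with a residue-transcendental generator over
a separably closed field.** Thm. 1.1: "Let `(F|K,v)` be a valued function field without
transcendence defect. If `(K,v)` is a defectless field, then `(F,v)` is a defectless field. The
same holds for 'inseparably defectless' in the place of 'defectless'. If `vK` is cofinal in `vF`,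
then it also holds for 'separably defectless' in the place of 'defectless'." As quoted in
Kuhlmann 2019, proof of Prop. 5.6: "We have already noted that `(K,P₁)` is a separably tame and
hence separably defectless field. Since `xP₁` is transcendental over `KP₁`, we can apply
[16, Theorem 1] to find that `(K(x),P₁)` is a separably defectless field." Vendored for
`F = K(x)` with `x` residue-transcendental over `K` (`IsResidueTranscendental`: `x ∈ V` with
residue transcendental over `Kv`, so that `x` is transcendental over `K`, `vK(x) = vK`,
`K(x)v = Kv(xv)` — Kuhlmann 2010, Lemma 2.5 — and `trdeg = 1 = trdeg K(x)v|Kv`: no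
transcendence defect) and `K ≤ Ω` a separably closed field — a separably defectless field for
every valuation, having no proper finite separable extension — with `vK` cofinal in `vK(x)`
(automatic here, `isValueCofinal_closure_of_isResidueTranscendental`, kept as printed): then
`(K(x), V ∩ K(x))` is a separably defectless field. The value-transcendental twin is
`Kuhlmann2010SeparablyDefectlessRational_sepClosed` (Steps file). Its printed proof (§5, p. 20:
passage to the completion, [K6], and the "defectless" version of Thm. 1.1) is not available in
Mathlib. Users take `(h : Kuhlmann2010SeparablyDefectlessRationalRT_sepClosed)`.
[cite: Kuhlmann2010, Thm. 1.1] -/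
def Kuhlmann2010SeparablyDefectlessRationalRT_sepClosed : Prop :=
  ∀ (Ω : Type u) [Field Ω] (V : ValuationSubring Ω) (K : Subfield Ω) (x : Ω),
    IsSepClosed K → IsResidueTranscendental V K x →
    IsValueCofinal V K (Subfield.closure ((K : Set Ω) ∪ {x})) →
    IsSeparablyDefectlessField (Subfield.closure ((K : Set Ω) ∪ {x}))
      (V.comap (algebraMap (Subfield.closure ((K : Set Ω) ∪ {x})) Ω))

/-! ### API -/

section API

variable {Ω : Type u} [Field Ω] (V : ValuationSubring Ω)

/-- **`vK` is cofinal in `vK(x)` for a residue-transcendental `x`** — indeed `vK(x) = vK`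
(Kuhlmann 2010, Lemma 2.5, `valueSubgroup_adjoin_eq_of_isResidueTranscendental`): every value of
a non-zero element of `K(x)` is the value of a non-zero element of `K`. PROVED.
[cite: Kuhlmann2010, Lemma 2.5] -/
theorem isValueCofinal_closure_of_isResidueTranscendental {K : Subfield Ω} {x : Ω}
    (hx : IsResidueTranscendental V K x) :
    IsValueCofinal V K (Subfield.closure ((K : Set Ω) ∪ {x})) := by
  intro a ha ha0
  have ha' : a ∈ (IntermediateField.adjoin K ({x} : Set Ω)).toSubfield :=
    (mem_adjoin_subfield_iff K {x} a).mpr ha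
  have hva : V.valuation a ≠ 0 := (map_ne_zero _).mpr ha0
  set γ : (ValuationSubring.ValueGroup V)ˣ := Units.mk0 _ hva with hγ
  have hγx : γ ∈ valueSubgroup (IntermediateField.adjoin K ({x} : Set Ω)).toSubfield V :=
    (mem_valueSubgroup_iff _ V γ).mpr ⟨⟨a, ha'⟩, fun h0 => ha0 (congrArg Subtype.val h0), rfl⟩
  rw [valueSubgroup_adjoin_eq_of_isResidueTranscendental V hx] at hγx
  obtain ⟨c, hc0, hγc⟩ := (mem_valueSubgroup_iff K V γ).mp hγx
  refine ⟨c, c.2, fun h0 => hc0 (Subtype.ext h0), le_of_eq ?_⟩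
  have : (γ : ValuationSubring.ValueGroup V) = V.valuation a := by rw [hγ, Units.val_mk0]
  rw [← this]
  exact hγc.symm

/-- The fact `Kuhlmann2010SeparablyDefectlessRationalRT_sepClosed` with its cofinality
hypothesis discharged: for `K` separably closed and `x` residue-transcendental over `K`,
`(K(x), V ∩ K(x))` is a separably defectless field. [cite: Kuhlmann2010, Thm. 1.1] -/
theorem Kuhlmann2010SeparablyDefectlessRationalRT_sepClosed.apply
    (h : Kuhlmann2010SeparablyDefectlessRationalRT_sepClosed.{u}) (K : Subfield Ω) (x : Ω)
    [hK : IsSepClosed K] (hx : IsResidueTranscendental V K x) :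
    IsSeparablyDefectlessField (Subfield.closure ((K : Set Ω) ∪ {x}))
      (V.comap (algebraMap (Subfield.closure ((K : Set Ω) ∪ {x})) Ω)) :=
  h Ω V K x hK hx (isValueCofinal_closure_of_isResidueTranscendental V hx)

/-- The rank-one case of Prop. 5.6 (separably closed `K`) is literally Prop. 5.2: under
`IsRankOne V K` the conclusion of `Kuhlmann2019_Prop56_sepClosed` holds by
`Kuhlmann2019_Prop52_sepClosed` (the finite-rank hypothesis is not even needed).
[cite: Kuhlmann2019, Prop. 5.2 and Prop. 5.6] -/
theorem Kuhlmann2019_Prop52_sepClosed.prop56_of_isRankOne (h : Kuhlmann2019_Prop52_sepClosed.{u})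
    [IsAlgClosed Ω] (K F : Subfield Ω) (hK : IsSepClosed K) (hr : IsRankOne V K) (hKF : K ≤ F)
    (hfg : FGOver K F) (hsep : SeparablyGeneratedOver K F)
    (h1 : ∃ x ∈ F, Transcendental K x ∧
      ∀ z ∈ F, IsAlgebraic (IntermediateField.adjoin K ({x} : Set Ω)) z)
    (himm : IsImmediateOver V K F) :
    ∃ x ∈ F, Transcendental K x ∧ F ≤ henselization V (Subfield.closure ((K : Set Ω) ∪ {x})) :=
  h Ω V K F hK hr hKF hfg hsep h1 himm

end API

end Literature.AlgebraicGeometry.Resolution
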